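import Mathlib.Analysis.SpecialFunctions.Gaussian.FourierTransform
import Mathlib.Analysis.Calculus.Deriv.MeanValue
import Mathlib.Analysis.Complex.ExponentialBounds
import Literature.Analysis.FluidPDE.UniqueContinuationRescale
import HarnessLib

/-!
# Estimates of the first Carleman weight on the cut-off regions (Seregin 2014, (A.2.11)–(A.2.15), (A.3.13)–(A.3.14))

Analysis/FluidPDE support file (theorems only) in the backward-uniqueness track of **ns.S08**
(`ess_backward_uniqueness`, ESS 2003 Thm. 5.1 = Seregin 2014, Thm. A.3.5). After the first
Carleman inequality has been applied to the cut-off product `w = ηv`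
(`Carleman.core_first`), the proofs of Seregin's Lemmas A.1 and A.2 estimate the weight
`W = h^{-2a}(s) e^{-|y|²/4s}` (`Carleman.carlemanWeight`, `h(s) = s e^{(1-s)/3}`) from below on the
good region `]1/2, 1[ × B(·, 1)` and from above on the regions carrying `∇η`, `∂ₛη`: the top layer
`[3/2, 7/4] × B̄(0, ρ - 1/2)` (where `h^{-2a}(s) ≤ h^{-2a}(3/2)`, `h(3/2) > 1`) and the annulus
`[s₁, 7/4] × (B̄(0, ρ - 1/2) ∖ B(0, ρ - 1))` (where `e^{-|y|²/8s} ≤ e^{-ρ²/32s}`), with the choice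
`a = κρ²` ((A.2.13): `a = βρ²/(2 ln h(3/2))`). This file proves these elementary estimates:

* `Carleman.rpow_mul_exp_neg_le` — `x^p e^{-bx} ≤ (p/(eb))^p` (`x, p, b > 0`);
* `Carleman.log_hW_three_halves_le` — `ln h(3/2) ≤ 1/2` (the companion facts `h ≤ 1` on
  `[0, 1]`, `h` increasing on `[0, 3]`, `h(3/2) > 1`, `e^{-|y|²/2} ≤ W` on `[1/2, 1] × E` are in
  `UniqueContinuationRescale.lean`);
* `Carleman.carlemanWeight_le_rpow` — `W ≤ h(s₁)^{-2a}` on `{s₁ ≤ s ≤ 3}`;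
  `Carleman.carlemanWeight_mul_exp_le` — `W e^{q|y|²} ≤ h^{-2a}e^{-|y|²/8s}` (`q ≤ 1/16`, `s ≤ 2`);
* `Carleman.annulus_weight_le` — on the annulus, `h^{-2a}(s)e^{-|y|²/8s} ≤ e^{-ρ²/128}` for
  `a = κρ²`, `0 < κ ≤ 1/256`;
* `Carleman.weight_integral_le` — `∫_{top ∪ annulus} h^{-2a}(s) e^{-|y|²/8s} ≤ C(dim E) h(3/2)^{-2a}`
  for `a = κρ²`, `0 < κ ≤ 1/256`, `ρ ≥ 2` ((A.2.11)–(A.2.15), (A.3.13)–(A.3.14): the source bounds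
  `∫₀² h^{-2a}(s)e^{-ρ²/16s} ds` by monotonicity of the integrand; here by the pointwise bound).

All statements are proved; no definitions.

## References

* G. Seregin, *Lecture notes on regularity theory for the Navier–Stokes equations*, World
  Scientific 2014, App. A.2, (A.2.11)–(A.2.16); App. A.3, (A.3.12)–(A.3.14). [Seregin2014]
-/

noncomputable section

open MeasureTheory Set Function Filter Metric Real
open _root_.Topology
open scoped InnerProductSpace RealInnerProductSpace ENNReal

namespace Literature.Analysis.FluidPDE

namespace Carleman

/-! ### Elementary inequalities -/

section Elementary

/-- **`x^p e^{-bx} ≤ (p/(eb))^p`** for `x, p, b > 0` (the maximum is attained at `x = p/b`;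
equivalently `ln u ≤ u - 1` for `u = bx/p`). [folklore] -/
theorem rpow_mul_exp_neg_le {p b x : ℝ} (hp : 0 < p) (hb : 0 < b) (hx : 0 < x) :
    x ^ p * Real.exp (-(b * x)) ≤ (p / (Real.exp 1 * b)) ^ p := by
  have hq : 0 < p / (Real.exp 1 * b) := by positivity
  rw [Real.rpow_def_of_pos hx, ← Real.exp_add, Real.rpow_def_of_pos hq, Real.exp_le_exp]
  -- `p log x - b x ≤ p log (p/(e b))`
  have hu : 0 < b * x / p := by positivity
  have hlog := Real.log_le_sub_one_of_pos hu
  rw [Real.log_div (by positivity) hp.ne', Real.log_mul hb.ne' hx.ne'] at hlog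
  rw [Real.log_div hp.ne' (by positivity), Real.log_mul (Real.exp_pos 1).ne' hb.ne', Real.log_exp]
  have h2 := mul_le_mul_of_nonneg_right hlog hp.le
  have e1 : (b * x / p - 1) * p = b * x - p := by field_simp
  rw [e1] at h2
  linarith

/-- `ln h(3/2) ≤ 1/2` (`h(3/2) ≤ 3/2 ≤ e^{1/2}`). [folklore] -/
theorem log_hW_three_halves_le : Real.log (hW (3 / 2)) ≤ 1 / 2 := by
  have hpos : 0 < hW (3 / 2) := lt_trans zero_lt_one one_lt_hW_three_halves
  rw [Real.log_le_iff_le_exp hpos]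
  unfold hW
  have h1 : Real.exp ((1 - 3 / 2) / 3) ≤ 1 := by
    rw [Real.exp_le_one_iff]; norm_num
  have h2 : (3 / 2 : ℝ) ≤ Real.exp (1 / 2) := by
    have := Real.add_one_le_exp (1 / 2 : ℝ)
    linarith
  calc 3 / 2 * Real.exp ((1 - 3 / 2) / 3) ≤ 3 / 2 * 1 :=
        mul_le_mul_of_nonneg_left h1 (by norm_num)
    _ ≤ Real.exp (1 / 2) := by linarith

end Elementary

/-! ### Pointwise bounds for the weight -/

section Pointwise

variable {E : Type*} [NormedAddCommGroup E]

/-- **Upper bound above a time level**: for `0 < s₁ ≤ s ≤ 3` and `a ≥ 0`,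
`h^{-2a}(s) e^{-|y|²/4s} ≤ h(s₁)^{-2a}` (`h` increasing). [folklore] -/
theorem carlemanWeight_le_rpow {a s₁ : ℝ} (ha : 0 ≤ a) (hs₁ : 0 < s₁) {z : ℝ × E}
    (hz1 : s₁ ≤ z.1) (hz3 : z.1 ≤ 3) : carlemanWeight a z ≤ hW s₁ ^ (-(2 * a)) := by
  have hs : 0 < z.1 := lt_of_lt_of_le hs₁ hz1
  unfold carlemanWeight
  have h1 : hW z.1 ^ (-(2 * a)) ≤ hW s₁ ^ (-(2 * a)) :=
    Real.rpow_le_rpow_of_nonpos (hW_pos hs₁)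
      (monotoneOn_hW ⟨hs₁.le, by linarith⟩ ⟨hs.le, hz3⟩ hz1) (by linarith)
  have h2 : Real.exp (-‖z.2‖ ^ 2 / (4 * z.1)) ≤ 1 := by
    rw [Real.exp_le_one_iff, neg_div]
    exact neg_nonpos.2 (by positivity)
  calc hW z.1 ^ (-(2 * a)) * Real.exp (-‖z.2‖ ^ 2 / (4 * z.1)) ≤ hW s₁ ^ (-(2 * a)) * 1 :=
        mul_le_mul h1 h2 (Real.exp_pos _).le (Real.rpow_nonneg (hW_pos hs₁).le _)
    _ = hW s₁ ^ (-(2 * a)) := mul_one _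

/-- **The weight on the annulus** (Seregin 2014, (A.3.13)–(A.3.14) / (A.2.12)–(A.2.15)): for
`0 < s ≤ 2`, `ρ ≥ 2`, `r ≥ ρ - 1` and `a = κρ²` with `0 < κ ≤ 1/256`,
`h^{-2a}(s) e^{-r²/8s} ≤ e^{-ρ²/128}`
(`(ρ-1)² ≥ ρ²/4`; for `s ≤ 1`: `h(s) ≥ s` and `s^{-2a}e^{-ρ²/64s} ≤ (128κ/e)^{2a} ≤ 1`; for
`1 ≤ s ≤ 2`: `h(s)^{-2a} ≤ e^{2a/3} = e^{2κρ²/3}`). [cite: Seregin2014, App. A.3 (A.3.13)–(A.3.14)] -/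
theorem annulus_weight_le {κ ρ s r : ℝ} (hκ : 0 < κ) (hκ0 : κ ≤ 1 / 256) (hρ : 2 ≤ ρ)
    (hs : 0 < s) (hs2 : s ≤ 2) (hr : ρ - 1 ≤ r) :
    hW s ^ (-(2 * (κ * ρ ^ 2))) * Real.exp (-r ^ 2 / (8 * s)) ≤ Real.exp (-ρ ^ 2 / 128) := by
  set a : ℝ := κ * ρ ^ 2 with ha
  have ha0 : 0 < a := by positivity
  have hr0 : 0 ≤ r := le_trans (by linarith) hr
  -- `e^{-r²/8s} ≤ e^{-ρ²/32 s}`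
  have hr2 : ρ ^ 2 / 4 ≤ r ^ 2 := by nlinarith
  have hexp : Real.exp (-r ^ 2 / (8 * s)) ≤ Real.exp (-(ρ ^ 2 / (32 * s))) := by
    rw [Real.exp_le_exp, neg_div, neg_le_neg_iff, div_le_div_iff₀ (by positivity) (by positivity)]
    nlinarith
  have he1 : (2.56 : ℝ) < Real.exp 1 := by linarith [Real.exp_one_gt_d9]
  rcases le_or_gt s 1 with hs1 | hs1
  · -- ### `s ≤ 1`: `h(s) ≥ s`, and `s^{-2a} e^{-ρ²/64s} ≤ 1`
    have hh : s ≤ hW s := by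
      unfold hW
      have : 1 ≤ Real.exp ((1 - s) / 3) := Real.one_le_exp (by linarith)
      nlinarith
    have h1 : hW s ^ (-(2 * a)) ≤ s ^ (-(2 * a)) :=
      Real.rpow_le_rpow_of_nonpos hs hh (by linarith)
    -- `s^{-2a} e^{-ρ²/(64 s)} ≤ 1` via `x^p e^{-bx} ≤ (p/(eb))^p` with `x = 1/s`
    have h2 : s ^ (-(2 * a)) * Real.exp (-(ρ ^ 2 / (64 * s))) ≤ 1 := by
      have hx : 0 < 1 / s := by positivity
      have h := rpow_mul_exp_neg_le (p := 2 * a) (b := ρ ^ 2 / 64) (by positivity)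
        (by positivity) hx
      have e1 : (1 / s) ^ (2 * a) = s ^ (-(2 * a)) := by
        rw [one_div, Real.inv_rpow hs.le, Real.rpow_neg hs.le]
      have e2 : -(ρ ^ 2 / 64 * (1 / s)) = -(ρ ^ 2 / (64 * s)) := by field_simp
      rw [e1, e2] at h
      refine h.trans ?_
      have hbase : 2 * a / (Real.exp 1 * (ρ ^ 2 / 64)) ≤ 1 := by
        rw [div_le_one (by positivity), ha]
        nlinarith [sq_nonneg ρ, mul_pos hκ (by positivity : (0 : ℝ) < ρ ^ 2)]
      exact Real.rpow_le_one (by positivity) hbase (by positivity)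
    calc hW s ^ (-(2 * a)) * Real.exp (-r ^ 2 / (8 * s))
        ≤ s ^ (-(2 * a)) * Real.exp (-(ρ ^ 2 / (32 * s))) :=
          mul_le_mul h1 hexp (Real.exp_pos _).le (Real.rpow_nonneg hs.le _)
      _ = (s ^ (-(2 * a)) * Real.exp (-(ρ ^ 2 / (64 * s)))) * Real.exp (-(ρ ^ 2 / (64 * s))) := by
          rw [mul_assoc, ← Real.exp_add]; congr 1; field_simp; ring
      _ ≤ 1 * Real.exp (-(ρ ^ 2 / (64 * s))) :=
          mul_le_mul_of_nonneg_right h2 (Real.exp_pos _).le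
      _ ≤ Real.exp (-ρ ^ 2 / 128) := by
          rw [one_mul, Real.exp_le_exp, neg_div, neg_le_neg_iff,
            div_le_div_iff₀ (by positivity) (by positivity)]
          nlinarith
  · -- ### `1 < s ≤ 2`: `h(s)^{-2a} ≤ e^{2a/3}`
    have h1 : hW s ^ (-(2 * a)) ≤ Real.exp (2 * a / 3) := by
      unfold hW
      rw [Real.mul_rpow (by linarith) (Real.exp_pos _).le]
      have hsa : s ^ (-(2 * a)) ≤ 1 := Real.rpow_le_one_of_one_le_of_nonpos hs1.le (by linarith)
      have hea : Real.exp ((1 - s) / 3) ^ (-(2 * a)) = Real.exp (2 * a / 3 * (s - 1)) := by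
        rw [← Real.exp_mul]; congr 1; ring
      rw [hea]
      calc s ^ (-(2 * a)) * Real.exp (2 * a / 3 * (s - 1)) ≤ 1 * Real.exp (2 * a / 3 * 1) := by
            refine mul_le_mul hsa (Real.exp_le_exp.2 ?_) (Real.exp_pos _).le zero_le_one
            exact mul_le_mul_of_nonneg_left (by linarith) (by positivity)
        _ = Real.exp (2 * a / 3) := by rw [one_mul, mul_one]
    calc hW s ^ (-(2 * a)) * Real.exp (-r ^ 2 / (8 * s))
        ≤ Real.exp (2 * a / 3) * Real.exp (-(ρ ^ 2 / (32 * s))) :=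
          mul_le_mul h1 hexp (Real.exp_pos _).le (Real.exp_pos _).le
      _ ≤ Real.exp (2 * a / 3) * Real.exp (-(ρ ^ 2 / 64)) := by
          refine mul_le_mul_of_nonneg_left (Real.exp_le_exp.2 ?_) (Real.exp_pos _).le
          rw [neg_le_neg_iff, div_le_div_iff₀ (by positivity) (by positivity)]
          nlinarith
      _ = Real.exp (2 * a / 3 - ρ ^ 2 / 64) := by rw [← Real.exp_add]; ring_nf
      _ ≤ Real.exp (-ρ ^ 2 / 128) := by
          rw [Real.exp_le_exp, ha]
          nlinarith [sq_nonneg ρ]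

/-- **Gaussian growth is absorbed by the weight** (Seregin 2014, (A.3.12)–(A.3.13)): for
`0 < s ≤ 2` and `0 ≤ q ≤ 1/16`, `h^{-2a}(s) e^{-|y|²/4s} e^{q|y|²} ≤ h^{-2a}(s) e^{-|y|²/8s}`. [cite: Seregin2014, App. A.3 (A.3.12)] -/
theorem carlemanWeight_mul_exp_le (a : ℝ) {q : ℝ} (hq : 0 ≤ q) (hq' : q ≤ 1 / 16) {z : ℝ × E}
    (hz : 0 < z.1) (hz2 : z.1 ≤ 2) :
    carlemanWeight a z * Real.exp (q * ‖z.2‖ ^ 2) ≤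
      hW z.1 ^ (-(2 * a)) * Real.exp (-‖z.2‖ ^ 2 / (8 * z.1)) := by
  unfold carlemanWeight
  rw [mul_assoc, ← Real.exp_add]
  refine mul_le_mul_of_nonneg_left (Real.exp_le_exp.2 ?_) (Real.rpow_nonneg (hW_pos hz).le _)
  rw [neg_div, neg_div]
  have h16 : q * (8 * z.1) ≤ 1 := by nlinarith
  have hy : 0 ≤ ‖z.2‖ ^ 2 := sq_nonneg _
  have e1 : ‖z.2‖ ^ 2 / (4 * z.1) = 2 * (‖z.2‖ ^ 2 / (8 * z.1)) := by
    field_simp; ring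
  have e2 : q * ‖z.2‖ ^ 2 ≤ ‖z.2‖ ^ 2 / (8 * z.1) := by
    rw [le_div_iff₀ (by positivity)]
    nlinarith [mul_nonneg hq hy]
  linarith

end Pointwise

/-! ### Integrals of the weight over the cut-off regions -/

section Integrals

variable {E : Type*} [NormedAddCommGroup E] [InnerProductSpace ℝ E] [FiniteDimensional ℝ E]
  [MeasurableSpace E] [BorelSpace E]

/-- The Gaussian integral `∫_E e^{-|y|²/14} dy = (14π)^{n/2}`. [folklore] -/
theorem integral_exp_neg_norm_sq_div : ∫ y : E, Real.exp (-‖y‖ ^ 2 / 14) =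
    (14 * Real.pi) ^ (Module.finrank ℝ E / 2 : ℝ) := by
  have h := GaussianFourier.integral_rexp_neg_mul_sq_norm (V := E) (b := 1 / 14) (by norm_num)
  have e : (fun y : E => Real.exp (-(1 / 14) * ‖y‖ ^ 2)) = fun y => Real.exp (-‖y‖ ^ 2 / 14) := by
    funext y; congr 1; ring
  rw [e] at h
  rw [h]
  congr 1
  field_simp

/-- The Gaussian `e^{-|y|²/14}` is integrable on `E`. [folklore] -/
theorem integrable_exp_neg_norm_sq_div : Integrable fun y : E => Real.exp (-‖y‖ ^ 2 / 14) := by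
  refine Integrable.of_integral_ne_zero ?_
  rw [integral_exp_neg_norm_sq_div]
  positivity

/-- A polynomial is beaten by a Gaussian: `ρⁿ e^{-ρ²/256} ≤ (128 n/e)^{n/2} + 1` (`ρ ≥ 0`). [folklore] -/
theorem pow_mul_exp_neg_sq_le (n : ℕ) {ρ : ℝ} (hρ : 0 ≤ ρ) :
    ρ ^ n * Real.exp (-ρ ^ 2 / 256) ≤ (128 * n / Real.exp 1) ^ (n / 2 : ℝ) + 1 := by
  rcases Nat.eq_zero_or_pos n with hn | hn
  · subst hn
    simp only [pow_zero, one_mul, CharP.cast_eq_zero, mul_zero, zero_div, Real.rpow_zero]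
    have : Real.exp (-ρ ^ 2 / 256) ≤ 1 := by
      rw [Real.exp_le_one_iff, neg_div]; exact neg_nonpos.2 (by positivity)
    linarith
  rcases eq_or_lt_of_le hρ with hρ0 | hρ0
  · subst hρ0
    rw [zero_pow hn.ne', zero_mul]
    positivity
  have h := rpow_mul_exp_neg_le (p := n / 2) (b := 1 / 256) (x := ρ ^ 2) (by positivity)
    (by norm_num) (by positivity)
  have e1 : (ρ ^ 2) ^ (n / 2 : ℝ) = ρ ^ n := by
    rw [← Real.rpow_natCast ρ 2, ← Real.rpow_mul hρ, ← Real.rpow_natCast ρ n]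
    congr 1; push_cast; ring
  have e2 : -(1 / 256 * ρ ^ 2) = -ρ ^ 2 / 256 := by ring
  have e3 : (n / 2 : ℝ) / (Real.exp 1 * (1 / 256)) = 128 * n / Real.exp 1 := by
    field_simp; ring
  rw [e1, e2, e3] at h
  linarith

/-- **The weight integral over the cut-off regions** (Seregin 2014, (A.2.11)–(A.2.15),
(A.3.13)–(A.3.14)): there is `C = C(dim E) > 0` such that for `ρ ≥ 2`, `0 < s₁`, and `a = κρ²`
with `0 < κ ≤ 1/256`,
`∫_{([3/2,7/4]×B̄(0,ρ-1/2)) ∪ ([s₁,7/4]×(B̄(0,ρ-1/2)∖B(0,ρ-1)))} h^{-2a}(s) e^{-|y|²/8s} ≤ C h(3/2)^{-2a}`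
(top layer: `h^{-2a}(s) ≤ h^{-2a}(3/2)` and the Gaussian integral; annulus:
`annulus_weight_le` and `|B̄(0,ρ)| e^{-ρ²/128} ≤ C' e^{-ρ²/256} ≤ C' h(3/2)^{-2a}` as
`2κ ln h(3/2) ≤ 1/256`). [cite: Seregin2014, App. A.2 (A.2.11)–(A.2.15)] -/
theorem weight_integral_le (E : Type*) [NormedAddCommGroup E] [InnerProductSpace ℝ E]
    [FiniteDimensional ℝ E] [MeasurableSpace E] [BorelSpace E] :
    ∃ C : ℝ, 0 < C ∧ ∀ (ρ s₁ κ : ℝ), 2 ≤ ρ → 0 < s₁ → 0 < κ → κ ≤ 1 / 256 →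
      ∫ z in (Icc (3 / 2 : ℝ) (7 / 4) ×ˢ closedBall (0 : E) (ρ - 1 / 2)) ∪
          (Icc s₁ (7 / 4) ×ˢ (closedBall (0 : E) (ρ - 1 / 2) \ ball 0 (ρ - 1))),
        hW z.1 ^ (-(2 * (κ * ρ ^ 2))) * Real.exp (-‖z.2‖ ^ 2 / (8 * z.1)) ≤
      C * hW (3 / 2) ^ (-(2 * (κ * ρ ^ 2))) := by
  set V₁ : ℝ := (volume (ball (0 : E) 1)).toReal with hV₁
  have hV₁0 : 0 ≤ V₁ := ENNReal.toReal_nonneg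
  set M : ℝ := (128 * (Module.finrank ℝ E) / Real.exp 1) ^ ((Module.finrank ℝ E) / 2 : ℝ) + 1 with hM
  have hM0 : 0 < M := by positivity
  set Gn : ℝ := (14 * Real.pi) ^ ((Module.finrank ℝ E) / 2 : ℝ) with hGn
  have hGn0 : 0 < Gn := by positivity
  refine ⟨1 / 4 * Gn + 2 * V₁ * M + 1, by positivity, ?_⟩
  intro ρ s₁ κ hρ hs₁ hκ hκ0
  set a : ℝ := κ * ρ ^ 2 with ha
  have ha0 : 0 < a := by positivity
  have hh32 : 0 < hW (3 / 2) := lt_trans zero_lt_one one_lt_hW_three_halves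
  set Stop : Set (ℝ × E) := Icc (3 / 2 : ℝ) (7 / 4) ×ˢ closedBall (0 : E) (ρ - 1 / 2) with hStop
  set Sann : Set (ℝ × E) := Icc s₁ (7 / 4) ×ˢ (closedBall (0 : E) (ρ - 1 / 2) \ ball 0 (ρ - 1))
    with hSann
  set f : ℝ × E → ℝ := fun z => hW z.1 ^ (-(2 * a)) * Real.exp (-‖z.2‖ ^ 2 / (8 * z.1)) with hf
  have htopm : MeasurableSet Stop := measurableSet_Icc.prod measurableSet_closedBall
  have hannm : MeasurableSet Sann :=
    measurableSet_Icc.prod (measurableSet_closedBall.diff measurableSet_ball)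
  -- ### continuity of `f` on `{s > 0}` and integrability on a compact box
  set s₀ : ℝ := min s₁ (3 / 2) with hs₀
  have hs₀0 : 0 < s₀ := lt_min hs₁ (by norm_num)
  set K : Set (ℝ × E) := Icc s₀ (7 / 4) ×ˢ closedBall (0 : E) (ρ - 1 / 2) with hK
  have hKc : IsCompact K := isCompact_Icc.prod (isCompact_closedBall _ _)
  have htopK : Stop ⊆ K := Set.prod_mono (Icc_subset_Icc_left (min_le_right _ _)) Subset.rfl
  have hannK : Sann ⊆ K := Set.prod_mono (Icc_subset_Icc_left (min_le_left _ _)) Set.sdiff_subset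
  have hKpos : ∀ z ∈ K, 0 < z.1 := fun z hz => lt_of_lt_of_le hs₀0 hz.1.1
  have hfc : ContinuousOn f K := by
    refine ContinuousOn.mul ?_ ?_
    · refine ContinuousOn.rpow_const ?_ fun z hz => Or.inl (hW_pos (hKpos z hz)).ne'
      exact (continuous_fst.mul ((continuous_const.sub continuous_fst).div_const _).rexp).continuousOn
    · refine (ContinuousOn.div ?_ ?_ fun z hz => mul_ne_zero (by norm_num) (hKpos z hz).ne').rexp
      · exact (continuous_snd.norm.pow 2).neg.continuousOn
      · exact (continuous_const.mul continuous_fst).continuousOn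
  have hfK : IntegrableOn f K := hfc.integrableOn_compact hKc
  have hf0 : ∀ z ∈ K, 0 ≤ f z := fun z hz =>
    mul_nonneg (Real.rpow_nonneg (hW_pos (hKpos z hz)).le _) (Real.exp_pos _).le
  -- ### split the union
  have hsplit : ∫ z in Stop ∪ Sann, f z ≤ (∫ z in Stop, f z) + ∫ z in Sann, f z := by
    rw [← Set.union_sdiff_self]
    rw [setIntegral_union disjoint_sdiff_right (hannm.diff htopm) (hfK.mono_set htopK)
      (hfK.mono_set (Set.sdiff_subset.trans hannK))]
    refine add_le_add le_rfl (setIntegral_mono_set (hfK.mono_set hannK) ?_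
      (Eventually.of_forall fun z (hz : z ∈ Sann \ Stop) => hz.1))
    exact ae_restrict_of_forall_mem hannm fun z hz => hf0 z (hannK hz)
  -- ### the top layer
  have htop : ∫ z in Stop, f z ≤ hW (3 / 2) ^ (-(2 * a)) * (1 / 4 * Gn) := by
    set g : ℝ × E → ℝ := fun z => hW (3 / 2) ^ (-(2 * a)) * Real.exp (-‖z.2‖ ^ 2 / 14) with hg
    -- `g` is integrable on the slab `[3/2, 7/4] × E`, with integral `h(3/2)^{-2a} · (1/4) · Gn`
    have hμ : (volume.restrict (Icc (3 / 2 : ℝ) (7 / 4) ×ˢ (univ : Set E)) : Measure (ℝ × E)) =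
        (volume.restrict (Icc (3 / 2 : ℝ) (7 / 4))).prod volume := by
      rw [Measure.volume_eq_prod, ← Measure.prod_restrict, Measure.restrict_univ]
    have hgi : IntegrableOn g (Icc (3 / 2 : ℝ) (7 / 4) ×ˢ (univ : Set E)) := by
      rw [IntegrableOn, hμ]
      exact (integrableOn_const (s := Icc (3 / 2 : ℝ) (7 / 4)) (C := hW (3 / 2) ^ (-(2 * a)))
        (by rw [Real.volume_Icc]; exact ENNReal.ofReal_ne_top) |>.mul_prod
        integrable_exp_neg_norm_sq_div)
    have hgval : ∫ z in Icc (3 / 2 : ℝ) (7 / 4) ×ˢ (univ : Set E), g z =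
        hW (3 / 2) ^ (-(2 * a)) * (1 / 4 * Gn) := by
      rw [hμ, integral_prod_mul (fun _ : ℝ => hW (3 / 2) ^ (-(2 * a)))
        (fun y : E => Real.exp (-‖y‖ ^ 2 / 14)), integral_exp_neg_norm_sq_div]
      simp only [integral_const, MeasurableSet.univ, Measure.restrict_apply, univ_inter,
        Real.volume_Icc, smul_eq_mul, Measure.real]
      rw [ENNReal.toReal_ofReal (by norm_num)]
      norm_num [hGn]
      ring
    -- pointwise `f ≤ g` on the top layer
    have hfg : ∀ z ∈ Stop, f z ≤ g z := by
      intro z hz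
      have hs : 3 / 2 ≤ z.1 := hz.1.1
      have hs' : z.1 ≤ 7 / 4 := hz.1.2
      have hzpos : 0 < z.1 := by linarith
      have h1 : hW z.1 ^ (-(2 * a)) ≤ hW (3 / 2) ^ (-(2 * a)) :=
        Real.rpow_le_rpow_of_nonpos hh32
          (monotoneOn_hW ⟨by norm_num, by norm_num⟩ ⟨hzpos.le, by linarith⟩ hs) (by linarith)
      have h2 : Real.exp (-‖z.2‖ ^ 2 / (8 * z.1)) ≤ Real.exp (-‖z.2‖ ^ 2 / 14) := by
        rw [Real.exp_le_exp, neg_div, neg_div, neg_le_neg_iff,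
          div_le_div_iff₀ (by norm_num) (by positivity)]
        nlinarith [sq_nonneg ‖z.2‖]
      exact mul_le_mul h1 h2 (Real.exp_pos _).le (Real.rpow_nonneg hh32.le _)
    calc ∫ z in Stop, f z ≤ ∫ z in Stop, g z :=
          setIntegral_mono_on (hfK.mono_set htopK) (hgi.mono_set (Set.prod_mono Subset.rfl
            (subset_univ _))) htopm hfg
      _ ≤ ∫ z in Icc (3 / 2 : ℝ) (7 / 4) ×ˢ (univ : Set E), g z := by
          refine setIntegral_mono_set hgi ?_
            (Eventually.of_forall (Set.prod_mono Subset.rfl (subset_univ _)))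
          exact Eventually.of_forall fun z => mul_nonneg (Real.rpow_nonneg hh32.le _)
            (Real.exp_pos _).le
      _ = _ := hgval
  -- ### the annulus
  have hann : ∫ z in Sann, f z ≤ 2 * V₁ * M * hW (3 / 2) ^ (-(2 * a)) := by
    -- pointwise bound
    have hptw : ∀ z ∈ Sann, f z ≤ Real.exp (-ρ ^ 2 / 128) := by
      intro z hz
      have hs0 : 0 < z.1 := lt_of_lt_of_le hs₁ hz.1.1
      have hs2 : z.1 ≤ 2 := by linarith [hz.1.2]
      have hr : ρ - 1 ≤ ‖z.2‖ := by
        have := hz.2.2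
        rw [mem_ball, dist_zero_right, not_lt] at this
        exact this
      exact annulus_weight_le hκ hκ0 hρ hs0 hs2 hr
    -- measure of the annulus
    have hvol : (volume Sann).toReal ≤ 2 * ρ ^ Module.finrank ℝ E * V₁ := by
      have h1 : volume Sann ≤ volume (Icc s₁ (7 / 4) ×ˢ closedBall (0 : E) ρ) :=
        measure_mono (Set.prod_mono Subset.rfl (Set.sdiff_subset.trans
          (closedBall_subset_closedBall (by linarith))))
      have h2 : volume (Icc s₁ (7 / 4) ×ˢ closedBall (0 : E) ρ) =
          ENNReal.ofReal (7 / 4 - s₁) *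
            (ENNReal.ofReal (ρ ^ Module.finrank ℝ E) * volume (ball (0 : E) 1)) := by
        rw [Measure.volume_eq_prod, Measure.prod_prod, Real.volume_Icc,
          Measure.addHaar_closedBall _ _ (by linarith : (0 : ℝ) ≤ ρ)]
      have hfin : volume (ball (0 : E) 1) ≠ ∞ := measure_ball_lt_top.ne
      have hρn : 0 ≤ ρ ^ Module.finrank ℝ E := pow_nonneg (by linarith) _
      have h74 : (ENNReal.ofReal (7 / 4 - s₁)).toReal ≤ 2 := by
        rcases le_or_gt (7 / 4 - s₁) 0 with h | h
        · rw [ENNReal.ofReal_of_nonpos h]; simp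
        · rw [ENNReal.toReal_ofReal h.le]; linarith
      have h3 : (volume (Icc s₁ (7 / 4) ×ˢ closedBall (0 : E) ρ)).toReal ≤
          2 * ρ ^ Module.finrank ℝ E * V₁ := by
        rw [h2, ENNReal.toReal_mul, ENNReal.toReal_mul, ENNReal.toReal_ofReal hρn, ← hV₁]
        calc (ENNReal.ofReal (7 / 4 - s₁)).toReal * (ρ ^ Module.finrank ℝ E * V₁)
            ≤ 2 * (ρ ^ Module.finrank ℝ E * V₁) :=
              mul_le_mul_of_nonneg_right h74 (mul_nonneg hρn hV₁0)
          _ = 2 * ρ ^ Module.finrank ℝ E * V₁ := by ring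
      have hne : volume (Icc s₁ (7 / 4) ×ˢ closedBall (0 : E) ρ) ≠ ∞ := by
        rw [h2]
        exact ENNReal.mul_ne_top ENNReal.ofReal_ne_top (ENNReal.mul_ne_top ENNReal.ofReal_ne_top hfin)
      exact (ENNReal.toReal_mono hne h1).trans h3
    have hvolfin : volume Sann ≠ ∞ := by
      refine ne_top_of_le_ne_top ?_ (measure_mono (Set.prod_mono Subset.rfl
        (Set.sdiff_subset.trans (closedBall_subset_closedBall (by linarith : ρ - 1 / 2 ≤ ρ)))))
      rw [Measure.volume_eq_prod, Measure.prod_prod, Real.volume_Icc]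
      exact ENNReal.mul_ne_top ENNReal.ofReal_ne_top measure_closedBall_lt_top.ne
    -- the decay beats the volume and the choice of `κ`
    have hdec : ρ ^ Module.finrank ℝ E * Real.exp (-ρ ^ 2 / 128) ≤ M * hW (3 / 2) ^ (-(2 * a)) := by
      have e1 : Real.exp (-ρ ^ 2 / 128) = Real.exp (-ρ ^ 2 / 256) * Real.exp (-ρ ^ 2 / 256) := by
        rw [← Real.exp_add]; congr 1; ring
      have h1 := pow_mul_exp_neg_sq_le (Module.finrank ℝ E) (by linarith : (0 : ℝ) ≤ ρ)
      have h2 : Real.exp (-ρ ^ 2 / 256) ≤ hW (3 / 2) ^ (-(2 * a)) := by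
        rw [Real.rpow_def_of_pos hh32, Real.exp_le_exp, ha]
        have := log_hW_three_halves_le
        have := log_hW_three_halves_pos
        nlinarith [sq_nonneg ρ, mul_le_mul_of_nonneg_right hκ0 (sq_nonneg ρ)]
      calc ρ ^ Module.finrank ℝ E * Real.exp (-ρ ^ 2 / 128)
          = (ρ ^ Module.finrank ℝ E * Real.exp (-ρ ^ 2 / 256)) * Real.exp (-ρ ^ 2 / 256) := by
            rw [e1]; ring
        _ ≤ M * hW (3 / 2) ^ (-(2 * a)) :=
          mul_le_mul h1 h2 (Real.exp_pos _).le hM0.le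
    calc ∫ z in Sann, f z ≤ ∫ z in Sann, Real.exp (-ρ ^ 2 / 128) :=
          setIntegral_mono_on (hfK.mono_set hannK) (integrableOn_const hvolfin) hannm hptw
      _ = (volume Sann).toReal * Real.exp (-ρ ^ 2 / 128) := by
          rw [setIntegral_const, smul_eq_mul, Measure.real]
      _ ≤ (2 * ρ ^ Module.finrank ℝ E * V₁) * Real.exp (-ρ ^ 2 / 128) :=
          mul_le_mul_of_nonneg_right hvol (Real.exp_pos _).le
      _ = 2 * V₁ * (ρ ^ Module.finrank ℝ E * Real.exp (-ρ ^ 2 / 128)) := by ring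
      _ ≤ 2 * V₁ * (M * hW (3 / 2) ^ (-(2 * a))) := mul_le_mul_of_nonneg_left hdec (by positivity)
      _ = 2 * V₁ * M * hW (3 / 2) ^ (-(2 * a)) := by ring
  -- ### assembly
  have hpow0 : 0 ≤ hW (3 / 2) ^ (-(2 * a)) := Real.rpow_nonneg hh32.le _
  calc ∫ z in Stop ∪ Sann, f z ≤ (∫ z in Stop, f z) + ∫ z in Sann, f z := hsplit
    _ ≤ hW (3 / 2) ^ (-(2 * a)) * (1 / 4 * Gn) + 2 * V₁ * M * hW (3 / 2) ^ (-(2 * a)) :=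
        add_le_add htop hann
    _ ≤ (1 / 4 * Gn + 2 * V₁ * M + 1) * hW (3 / 2) ^ (-(2 * a)) := by nlinarith

end Integrals

end Carleman

end Literature.Analysis.FluidPDE
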